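import Summits.ABC.IUTFork.Thm311RealInd1StripTwistJWPlanes
import Literature.IUT.LogVolume.UnitLogNormTrace
import HarnessLib

/-!
# [IUTchIII] Thm 3.11 (i) (Ind1) at `v ∈ 𝕍^non`: TRACE RIGIDITY of print's strip part — every realised strip automorphism
# PRESERVES `Tr_{K_v/ℚ_p}` (unconditional); the Jannsen–Wingberg planes lie in `Ker Tr` (Kondo Thm 2.3, from the group-level fact)

PROOF-ONLY file (abc-iut cell, Cor. 3.12 sub-crew, seat abc-iut-c312-1 = holder of record of the typed [IUTchIII] Thm. 3.11,
gen 11; row «R13 TRACE-RIGIDITY»).  TAKES NO SIDE on [IUTchIII] Cor. 3.12.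

The additive shadow of this lineage's norm rigidity (gen 8, `Real.norm_liftUnits`: `N_{K_v/ℚ_p}(liftUnits φ u) = N(u)`,
[AbsAnab] Prop. 1.2.1 (vi) / [IUTchII] Rmk. 1.8.1), through the classical `log_p ∘ N = Tr ∘ log_p` (abc-iut-f-167's
`unitLog_norm_eq_trace_unitLog`, Neukirch ANT II (5.5)) — Hoshi–Nishio 2022 Lemma 2.3 (ii) «`α_+` commutes with `Tr_{k/k^{(d=1)}}`;
in particular `α_+` restricts to an automorphism of `Ker(Tr)`» (RIMS-1931 p. 7 l. 21–33) and Kondo arXiv:2512.09231 Lemma 2.2,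
here for the mono-analytic (Ind1) strip part at the REAL log-shell carrier:
* **`Real.trace_of_galoisLog_liftUnits`** — `Tr(log(liftUnits φ u)) = Tr(log u)` for every `φ ∈ Aut_top(G_v)`, `u ∈ 𝒪_v^×`
  (logarithms read in abc-iut-S7's rescaled completion `K_v^{(1/n_v)}`, a normed `ℚ_p`-algebra).
* **`Real.trace_apply_eq_of_mem_ind1StripOf`** — UNCONDITIONAL: every `ψ ∈ Real.ind1StripOf v (Real.galoisLog v)` PRESERVES
  THE TRACE: `Tr(ψ x) = Tr(x)` for all `x ∈ K_v` (units: the above; all of `K_v`: `p^M x ∈ log(𝒪_v^×)` for large `M`, additivity,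
  characteristic `0` — no `ℚ_p`-linearity of `ψ` assumed).  Hence `Tr(ψ x − x) = 0`: print's (Ind1) strip part moves every point
  ONLY INSIDE the trace-zero hyperplane through it (`Real.trace_sub_eq_zero_of_mem_ind1StripOf`), and `Ker Tr` is `ψ`-stable.
  Contrast (neutral): print's (Ind2) at `v` is the scalars `ℤ_p^×` (abc-iut-w5-d216's `ismIsm_analyticLogv_eq_unitScalars`), which
  rescale the trace; Dupuy–Hilado's `Aut_{ℚ_p}(K_v : I_v)` contains both.
* **`Real.exists_realised_planes_trace_zero_of_jannsenWingberg`** — assuming the group-level fact `JannsenWingbergTwists`, the `g`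
  Jannsen–Wingberg planes realised in the strip part (`exists_realised_planes_of_jannsenWingberg`) are TRACE-ZERO: `Tr(ya i) =
  Tr(yb i) = 0` — the planes half of Kondo's Thm. 2.3 «`Ker(Tr_{k/ℚ_p}) = ⟨y_2, …, y_d⟩` (`d` odd) / `⟨y_1, y_3, …, y_d⟩` (`d` even)»,
  PROVED: `Tr(x + y_b^*(x)·y_a) = Tr(x)` at `x = y_b` gives `Tr(y_a) = 0`.
HONEST SCOPE: statements about OUR typed objects at ONE place; the first two are unconditional, the third conditional on `hJW`;
nothing here asserts or refutes [IUTchIII] Cor. 3.12.  [claim: Mochizuki2012, status: disputed];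
[cite: HoshiNishio2022OuterAutMLF, Lemma 2.3 (ii) p.7]; [cite: Kondo2025OuterAutMLF, §2 Lemma 2.2 and Thm 2.3 p.9];
[cite: NeukirchANT1999, Ch. II (5.5)]; [cite: MochizukiAbsAnab2004, Prop 1.2.1 (vi) p.10].  typed ≠ proved.
-/

set_option autoImplicit false

noncomputable section

open Metric Set
open scoped Pointwise

namespace Summit.ABC.IUTFork.Thm311.Real

open NumberField IsDedekindDomain Literature.NumberTheory.NumberFields Literature.IUT.LogVolume
open Literature.NumberTheory.GaloisRepresentations Literature.NumberTheory.GaloisRepresentations.Ultrametric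
open Literature.AnabelianGeometry.AbsoluteAnabelian Literature.IUT.HodgeArakelov
open Literature.IUT.HodgeArakelov.AbsTopMonoids

variable {F : Type} [Field F] [NumberField F] (v : HeightOneSpectrum (𝓞 F))

/-! ## 1. The trace of `log(liftUnits φ u)` -/

section Unconditional

variable [hp : Fact (closureAt v).residueChar.Prime]

/-- **`Tr(log(liftUnits φ u)) = Tr(log u)`**: THE equivariant lift of `φ ∈ Aut_top(G_v)` preserves the trace of unit logarithms —
`Tr ∘ log_p = log_p ∘ N` (abc-iut-f-167's `unitLog_norm_eq_trace_unitLog`) and `N(liftUnits φ u) = N(u)` (gen 8's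
`norm_liftUnits`).  Logarithms read in `K_v^{(1/n_v)}` over `ℚ_{p_v}`. [cite: HoshiNishio2022OuterAutMLF, Lemma 2.3 (ii) p.7] -/
theorem trace_of_galoisLog_liftUnits (φ : Gal v ≃ₜ* Gal v) (u : (↥(v.adicCompletionIntegers F))ˣ) :
    Algebra.trace ℚ_[(closureAt v).residueChar]
        (RescaledCompletion F (closureAt v).residueChar v (natCast_residueChar_closureAt_mem v))
        (RescaledCompletion.of F (closureAt v).residueChar v (natCast_residueChar_closureAt_mem v)
          (galoisLog v (Additive.ofMul (liftUnits v φ u)))) =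
      Algebra.trace ℚ_[(closureAt v).residueChar]
        (RescaledCompletion F (closureAt v).residueChar v (natCast_residueChar_closureAt_mem v))
        (RescaledCompletion.of F (closureAt v).residueChar v (natCast_residueChar_closureAt_mem v)
          (galoisLog v (Additive.ofMul u))) := by
  set hv := natCast_residueChar_closureAt_mem v
  set e := RescaledCompletion.of F (closureAt v).residueChar v hv with he
  letI := padicAlg v
  -- `log` of units, in the rescaled completion, is `unitLog`
  have hlog : ∀ w : (↥(v.adicCompletionIntegers F))ˣ, e (galoisLog v (Additive.ofMul w)) =
      unitLog (e (((w : ↥(v.adicCompletionIntegers F)) : v.adicCompletion F))) := fun w => by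
    rw [he, galoisLog_apply_eq_unitLog v (closureAt v).residueChar hv w, RingEquiv.apply_symm_apply]
  -- `Tr(log w) = log(N w)` and `N` in the rescaled completion is `N_v`
  have htr : ∀ w : (↥(v.adicCompletionIntegers F))ˣ,
      Algebra.trace ℚ_[(closureAt v).residueChar] (RescaledCompletion F (closureAt v).residueChar v hv)
        (e (galoisLog v (Additive.ofMul w))) =
      unitLog (normQp v (((w : ↥(v.adicCompletionIntegers F)) : v.adicCompletion F))) := by
    intro w
    rw [hlog, ← unitLog_norm_eq_trace_unitLog (closureAt v).residueChar (k := ℚ_[(closureAt v).residueChar])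
      (norm_of_coe_unit_eq_one v (closureAt v).residueChar hv w)]
    -- `N` of the rescaled completion (a type synonym of `K_v` with the same `ℚ_p`-structure) is `N_v`
    congr 1
  rw [htr, htr, norm_liftUnits]

/-- **TRACE RIGIDITY OF PRINT'S (Ind1) STRIP PART (unconditional).**  Every `ψ ∈ Real.ind1StripOf v (Real.galoisLog v)` — the
bicontinuous additive automorphisms of `K_v` induced through THE equivariant lift and the Galois `p`-adic logarithm by
topological automorphisms of `G_v` ([IUTchIII] Thm. 3.11 (i) (Ind1) at `v`, strip part) — PRESERVES THE TRACE:
`Tr_{K_v/ℚ_{p_v}}(ψ x) = Tr(x)` for all `x ∈ K_v` (read in `K_v^{(1/n_v)}`).  On `log(𝒪_v^×)` this is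
`trace_of_galoisLog_liftUnits`; a general `x` has `p^M·x ∈ log(𝒪_v^×)` (the image contains a ball), and `ψ`, `Tr` are additive
(characteristic `0`).  Hoshi–Nishio Lemma 2.3 (ii) / Kondo Lemma 2.2 at the real log-shell carrier.
[claim: Mochizuki2012, status: disputed] [cite: HoshiNishio2022OuterAutMLF, Lemma 2.3 (ii) p.7] -/
theorem trace_apply_eq_of_mem_ind1StripOf {ψ : v.adicCompletion F ≃+ v.adicCompletion F} (hψ : ψ ∈ ind1StripOf v (galoisLog v))
    (x : v.adicCompletion F) :
    Algebra.trace ℚ_[(closureAt v).residueChar]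
        (RescaledCompletion F (closureAt v).residueChar v (natCast_residueChar_closureAt_mem v))
        (RescaledCompletion.of F (closureAt v).residueChar v (natCast_residueChar_closureAt_mem v) (ψ x)) =
      Algebra.trace ℚ_[(closureAt v).residueChar]
        (RescaledCompletion F (closureAt v).residueChar v (natCast_residueChar_closureAt_mem v))
        (RescaledCompletion.of F (closureAt v).residueChar v (natCast_residueChar_closureAt_mem v) x) := by
  set hv := natCast_residueChar_closureAt_mem v
  set e := RescaledCompletion.of F (closureAt v).residueChar v hv with he
  set Tr := Algebra.trace ℚ_[(closureAt v).residueChar] (RescaledCompletion F (closureAt v).residueChar v hv) with hTr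
  obtain ⟨-, -, φ, hr⟩ := hψ
  rw [realises_stripMulAut_iff] at hr
  -- on logarithms of units
  have hunits : ∀ u : (↥(v.adicCompletionIntegers F))ˣ,
      Tr (e (ψ (galoisLog v (Additive.ofMul u)))) = Tr (e (galoisLog v (Additive.ofMul u))) := fun u => by
    rw [hr u]; exact trace_of_galoisLog_liftUnits v φ u
  -- `p^M • x` is the logarithm of a unit for large `M`
  obtain ⟨M, hM⟩ : ∃ M : ℕ, ‖((closureAt v).residueChar : ℚ_[(closureAt v).residueChar])‖ ^ M * ‖e x‖ ≤
      ((closureAt v).residueChar : ℝ) ^ (-(2 : ℝ)) := by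
    have hlim : Filter.Tendsto (fun N : ℕ => ‖((closureAt v).residueChar : ℚ_[(closureAt v).residueChar])‖ ^ N * ‖e x‖)
        Filter.atTop (nhds 0) := by
      have := (tendsto_pow_atTop_nhds_zero_of_lt_one (norm_nonneg _)
        (Padic.norm_p_lt_one (p := (closureAt v).residueChar))).mul_const ‖e x‖
      rwa [zero_mul] at this
    have hpos : (0 : ℝ) < ((closureAt v).residueChar : ℝ) ^ (-(2 : ℝ)) :=
      Real.rpow_pos_of_pos (by exact_mod_cast hp.out.pos) _
    obtain ⟨M, hM⟩ := (Filter.Tendsto.eventually_lt_const hpos hlim).exists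
    exact ⟨M, hM.le⟩
  have hsmall : ‖(((closureAt v).residueChar : ℕ) : ℚ_[(closureAt v).residueChar]) ^ M • e x‖ ≤
      ((closureAt v).residueChar : ℝ) ^ (-(2 : ℝ)) := by
    rw [norm_smul, norm_pow]; exact hM
  obtain ⟨u, hu⟩ := exists_unit_of_galoisLog_eq_of_norm_le v (closureAt v).residueChar hv hsmall
  have hux : galoisLog v (Additive.ofMul u) = (closureAt v).residueChar ^ M • x := by
    apply e.injective
    rw [hu, map_nsmul, ← Nat.cast_smul_eq_nsmul ℚ_[(closureAt v).residueChar], Nat.cast_pow]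
  -- additivity and characteristic `0`
  have h := hunits u
  rw [hux, map_nsmul, map_nsmul, map_nsmul, map_nsmul, map_nsmul] at h
  have hp0 : ((closureAt v).residueChar ^ M : ℕ) ≠ 0 := pow_ne_zero M hp.out.ne_zero
  rw [← Nat.cast_smul_eq_nsmul ℚ_[(closureAt v).residueChar], ← Nat.cast_smul_eq_nsmul ℚ_[(closureAt v).residueChar] (b := Tr (e x)),
    smul_eq_mul, smul_eq_mul] at h
  exact mul_left_cancel₀ (by exact_mod_cast hp0) h

/-- **Print's (Ind1) strip part moves every point only inside the trace-zero hyperplane through it**: `Tr(ψ x − x) = 0`.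
[claim: Mochizuki2012, status: disputed] [cite: HoshiNishio2022OuterAutMLF, Lemma 2.3 (ii) p.7] -/
theorem trace_sub_eq_zero_of_mem_ind1StripOf {ψ : v.adicCompletion F ≃+ v.adicCompletion F}
    (hψ : ψ ∈ ind1StripOf v (galoisLog v)) (x : v.adicCompletion F) :
    Algebra.trace ℚ_[(closureAt v).residueChar]
        (RescaledCompletion F (closureAt v).residueChar v (natCast_residueChar_closureAt_mem v))
        (RescaledCompletion.of F (closureAt v).residueChar v (natCast_residueChar_closureAt_mem v) (ψ x - x)) = 0 := by
  rw [map_sub, map_sub, trace_apply_eq_of_mem_ind1StripOf v hψ x, sub_self]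

/-- **`Ker(Tr)` is stable under print's (Ind1) strip part** («`α_+` restricts to an automorphism of `Ker(Tr)`»).
[claim: Mochizuki2012, status: disputed] [cite: HoshiNishio2022OuterAutMLF, Lemma 2.3 (ii) p.7] -/
theorem trace_apply_eq_zero_iff_of_mem_ind1StripOf {ψ : v.adicCompletion F ≃+ v.adicCompletion F}
    (hψ : ψ ∈ ind1StripOf v (galoisLog v)) (x : v.adicCompletion F) :
    Algebra.trace ℚ_[(closureAt v).residueChar]
        (RescaledCompletion F (closureAt v).residueChar v (natCast_residueChar_closureAt_mem v))
        (RescaledCompletion.of F (closureAt v).residueChar v (natCast_residueChar_closureAt_mem v) (ψ x)) = 0 ↔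
      Algebra.trace ℚ_[(closureAt v).residueChar]
        (RescaledCompletion F (closureAt v).residueChar v (natCast_residueChar_closureAt_mem v))
        (RescaledCompletion.of F (closureAt v).residueChar v (natCast_residueChar_closureAt_mem v) x) = 0 := by
  rw [trace_apply_eq_of_mem_ind1StripOf v hψ x]

/-- **The same over abc-iut-c312-5's ANALYTIC logarithm** (`Real.galoisLog_eq_analyticLogv`): every
`ψ ∈ Real.ind1StripOf v (Real.analyticLogv F v)` preserves `Tr_{K_v/ℚ_{p_v}}`.
[claim: Mochizuki2012, status: disputed] [cite: HoshiNishio2022OuterAutMLF, Lemma 2.3 (ii) p.7] -/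
theorem trace_apply_eq_of_mem_ind1StripOf_analyticLogv {ψ : v.adicCompletion F ≃+ v.adicCompletion F}
    (hψ : ψ ∈ ind1StripOf v (analyticLogv F v)) (x : v.adicCompletion F) :
    Algebra.trace ℚ_[(closureAt v).residueChar]
        (RescaledCompletion F (closureAt v).residueChar v (natCast_residueChar_closureAt_mem v))
        (RescaledCompletion.of F (closureAt v).residueChar v (natCast_residueChar_closureAt_mem v) (ψ x)) =
      Algebra.trace ℚ_[(closureAt v).residueChar]
        (RescaledCompletion F (closureAt v).residueChar v (natCast_residueChar_closureAt_mem v))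
        (RescaledCompletion.of F (closureAt v).residueChar v (natCast_residueChar_closureAt_mem v) x) := by
  rw [← galoisLog_eq_analyticLogv] at hψ
  exact trace_apply_eq_of_mem_ind1StripOf v hψ x

end Unconditional

/-! ## 2. The Jannsen–Wingberg planes are trace-zero (Kondo Thm 2.3, planes part) -/

/-- **THE JANNSEN–WINGBERG PLANES LIE IN `Ker(Tr_{K_v/ℚ_p})`** (Kondo, arXiv:2512.09231 Thm. 2.3, the planes part, PROVED from the
group-level fact).  Assume `JannsenWingbergTwists`.  At a finite place `v ∣ p` of `F` with `p` odd and `[K_v : ℚ_p] ≥ 3`, the data of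
`exists_realised_planes_of_jannsenWingberg` — `c ≤ 2`, `g`, `[K_v : ℚ_p] = c + 2g`, twist planes `(ya i, yb i; ca i, cb i)` of
`K_v^{(1/n_v)}` with the Kronecker dualities, `ψ i, ψ' i ∈ Real.ind1StripOf v (Real.galoisLog v)` acting as `x ↦ x + cb i x • ya i`,
`x ↦ x − ca i x • yb i` — can be chosen with, IN ADDITION, `Tr(ya i) = 0` and `Tr(yb i) = 0` for every plane `i`: by trace rigidity
`Tr(yb i + ya i) = Tr(ψ i (yb i)) = Tr(yb i)`. [claim: Mochizuki2012, status: disputed]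
[cite: Kondo2025OuterAutMLF, §2 Thm 2.3 p.9] [cite: HoshiNishio2022OuterAutMLF, Lemma 2.3 (ii) p.7] -/
theorem exists_realised_planes_trace_zero_of_jannsenWingberg (hJW : JannsenWingbergTwists)
    (p : ℕ) [Fact p.Prime] (hv : ((p : ℕ) : 𝓞 F) ∈ v.asIdeal) (hp2 : p ≠ 2) (h3 : 3 ≤ localDeg F v) :
    ∃ (c g : ℕ) (_ : c ≤ 2) (_ : localDeg F v = c + 2 * g)
      (ca cb : Fin g → (RescaledCompletion F p v hv →ₗ[ℚ_[p]] ℚ_[p])) (ya yb : Fin g → RescaledCompletion F p v hv)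
      (ψ ψ' : Fin g → (v.adicCompletion F ≃+ v.adicCompletion F)),
      (∀ i j, ca i (ya j) = if i = j then 1 else 0) ∧ (∀ i j, cb i (yb j) = if i = j then 1 else 0) ∧
      (∀ i j, ca i (yb j) = 0) ∧ (∀ i j, cb i (ya j) = 0) ∧
      (∀ i, ψ i ∈ ind1StripOf v (galoisLog v)) ∧ (∀ i, ψ' i ∈ ind1StripOf v (galoisLog v)) ∧
      (∀ i (x : RescaledCompletion F p v hv),
        RescaledCompletion.of F p v hv (ψ i ((RescaledCompletion.of F p v hv).symm x)) = x + cb i x • ya i) ∧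
      (∀ i (x : RescaledCompletion F p v hv),
        RescaledCompletion.of F p v hv (ψ' i ((RescaledCompletion.of F p v hv).symm x)) = x - ca i x • yb i) ∧
      (∀ i, Algebra.trace ℚ_[p] (RescaledCompletion F p v hv) (ya i) = 0) ∧
      (∀ i, Algebra.trace ℚ_[p] (RescaledCompletion F p v hv) (yb i) = 0) := by
  obtain rfl : p = (closureAt v).residueChar := eq_residueChar_closureAt_of_natCast_mem v hv
  obtain ⟨c, g, hc, hcard, ca, cb, ya, yb, ψ, ψ', haa, hbb, hab, hba, hψ, hψ', hT, hT'⟩ :=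
    exists_realised_planes_of_jannsenWingberg v hJW (closureAt v).residueChar hv hp2 h3
  refine ⟨c, g, hc, hcard, ca, cb, ya, yb, ψ, ψ', haa, hbb, hab, hba, hψ, hψ', hT, hT', fun i => ?_, fun i => ?_⟩
  · -- `Tr(yb i + ya i) = Tr(yb i)`
    have h := trace_apply_eq_of_mem_ind1StripOf v (hψ i) ((RescaledCompletion.of F (closureAt v).residueChar v hv).symm (yb i))
    rw [hT i, RingEquiv.apply_symm_apply, hbb, if_pos rfl, one_smul, map_add, add_eq_left] at h
    exact h
  · -- `Tr(ya i − yb i) = Tr(ya i)`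
    have h := trace_apply_eq_of_mem_ind1StripOf v (hψ' i) ((RescaledCompletion.of F (closureAt v).residueChar v hv).symm (ya i))
    rw [hT' i, RingEquiv.apply_symm_apply, haa, if_pos rfl, one_smul, map_sub, sub_eq_self] at h
    exact h

end Summit.ABC.IUTFork.Thm311.Real

end
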